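import Literature.NumberTheory.LFunctions.UniformClassGroupZeroSum
import HarnessLib

/-!
# The zero terms of a finite family of entire functions against the Thorner–Zaman weight, from a log-free
# density bound and a zero-free region given as HYPOTHESES (abstract Thorner–Zaman 2019, §4.3)

Topic `Literature/NumberTheory/LFunctions`, namespace `Literature.NumberTheory.LFunctions.EntireEF`.  Everything here is
PROVED (theorems only; no named facts).

This is the family-agnostic form of the tree's `…ClassPNTFamilyZeroSumZFR` (class group characters): for a finite
family `F_i` (`i ∈ ι`) of entire functions, non-zero at some `c₀`, with
* a window bound `Σ_{|γ−τ|≤1/2} m_i ≤ W₀ (A + log(|τ|+4))` (`0 ≤ A ≤ 4Q`), `|ι| ≤ Q⁴`, `Q ≥ 12`;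
* a log-free density bound for the family in `Q`-form: `Σ_i Σ_{|γ|≤T, β≥α} m_i ≤ D e^{b(a log Q + log(T+4))(1−α)}`;
* a zero-free region OFF an arbitrary "exceptional" predicate `E`: `β ≤ 1 − c_Z/(a log Q + log(|γ|+4))`,
there are `ν ∈ (0, 1/64]`, `a₀ ≥ 1`, `A₀ > 0` depending on `W₀, b, D, a` ONLY such that for `x ≥ Q^{a₀}`,
`x^{−ν} ≤ ε ≤ 1` and all finite sets `u_i` of non-trivial zeros,
`Σ_i Σ_{ρ ∈ u_i, ¬E ρ} m_i(ρ) ‖F(−ρ)‖ ≤ A₀ x (e^{−c_Z L/(4a log Q)} + e^{−√(c_Z L/4)}) + A₀ x^{1−ν}` (`L = log x`,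
`F` the Laplace transform of `tzTest L ε`) — `family_zeroSum_le_zfr`; its finite part is `family_finitePart_le_zfr`.
Fed with the class group family it is the tree's `fam_zeroSum_le_local_zfr`; fed with the Hecke `L`-functions of a
congruence class group (`RayClassFamily…`) it gives the ray-class version.

## References
* [ThornerZaman2019] J. Thorner, A. Zaman, Algebra Number Theory 13 (2019), §4.3, Lemmas 4.4–4.6.
* [Bombieri1987GrandCrible] E. Bombieri, Astérisque 18 (1987), §6 Théorème 14.
-/

noncomputable section

open Complex Real MeasureTheory Set Filter Topology
open scoped NumberField nonZeroDivisors

namespace Literature.NumberTheory.LFunctions.EntireEF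

open Literature.NumberTheory.LFunctions Literature.NumberTheory.LFunctions.NumberField
  Literature.NumberTheory.LFunctions.TZWeight

/-! ### The finite part -/

/-- **The finite part of the zero sum of a finite family, zero-free region as a parameter** (Thorner–Zaman
Lemmas 4.5–4.6, abstract): with the density bound (`𝓠 ≥ 1`), `c_Z > 0` such that every zero of the family with
`|γ| ≤ T₁`, `β ≥ 1/4`, off `E` has `β ≤ 1 − c_Z/(𝓠 + log(|γ|+4))`, `x > 1`, `T₁ ≥ 1`, `e^{b(𝓠 + log(2T₁+4))} ≤ x^{1/2}`:
`Σ_i Σ_{|γ| ≤ T₁, ¬E, β ≥ 1/4} m_i x^{β−1}/max(1,|γ|) ≤ 64 D (e^{−c_Z L/(4𝓠)} + e^{−√(c_Z L/4)})`.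
[cite: ThornerZaman2019, Lemmas 4.5–4.6] -/
theorem family_finitePart_le_zfr {ι : Type*} [Fintype ι] {F : ι → ℂ → ℂ} (hF : ∀ i, Differentiable ℂ (F i))
    {c₀ : ℂ} (hc₀ : ∀ i, F i c₀ ≠ 0) {b D 𝓠 : ℝ} (hb : 0 < b) (hD : 0 < D) (h𝓠1 : 1 ≤ 𝓠)
    (hdens : ∀ (T : ℝ), 1 ≤ T → ∀ u : ι → Finset ℂ,
        (∀ i, ∀ ρ ∈ u i, F i ρ = 0 ∧ 1 / 4 ≤ ρ.re ∧ ρ.re < 1 ∧ |ρ.im| ≤ T) →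
        ∀ α : ℝ, α ≤ 1 →
          ∑ i, ∑ ρ ∈ u i with α ≤ ρ.re, (analyticOrderNatAt (F i) ρ : ℝ) ≤
            D * Real.exp (b * (𝓠 + Real.log (T + 4))) ^ (1 - α))
    (E : ℂ → Prop) [DecidablePred E] {c_Z : ℝ} (hcZ : 0 < c_Z) {x T₁ : ℝ} (hx : 1 < x) (hT₁ : 1 ≤ T₁)
    (hzfr : ∀ i, ∀ ρ ∈ (finite_nontrivialZeros_inter (hF i) (hc₀ i) T₁).toFinset, ¬ E ρ → 1 / 4 ≤ ρ.re →
      ρ.re ≤ 1 - c_Z / (𝓠 + Real.log (|ρ.im| + 4)))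
    (hrange : Real.exp (b * (𝓠 + Real.log (2 * T₁ + 4))) ≤ x ^ ((1 : ℝ) / 2)) :
    ∑ i, ∑ ρ ∈ (finite_nontrivialZeros_inter (hF i) (hc₀ i) T₁).toFinset with (¬ E ρ ∧ 1 / 4 ≤ ρ.re),
        (analyticOrderNatAt (F i) ρ : ℝ) * x ^ (ρ.re - 1) / max 1 |ρ.im| ≤
      64 * D * (Real.exp (-(c_Z * Real.log x / (4 * 𝓠))) + Real.exp (-Real.sqrt (c_Z * Real.log x / 4))) := by
  classical
  have hmemFin : ∀ i (ρ : ℂ), ρ ∈ (finite_nontrivialZeros_inter (hF i) (hc₀ i) T₁).toFinset ↔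
      (F i ρ = 0 ∧ 0 < ρ.re ∧ ρ.re < 1) ∧ |ρ.im| ≤ T₁ := by
    intro i ρ; rw [Set.Finite.mem_toFinset]; rfl
  set Fin' : ι → Finset ℂ := fun i ↦
    ((finite_nontrivialZeros_inter (hF i) (hc₀ i) T₁).toFinset).filter (fun ρ ↦ ¬ E ρ ∧ 1 / 4 ≤ ρ.re) with hFin'
  set s : Finset (Σ _ : ι, ℂ) := Finset.univ.sigma Fin' with hs
  have hmem : ∀ p ∈ s, p.2 ∈ (finite_nontrivialZeros_inter (hF p.1) (hc₀ p.1) T₁).toFinset ∧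
      (F p.1 p.2 = 0 ∧ 0 < p.2.re ∧ p.2.re < 1) ∧ |p.2.im| ≤ T₁ ∧ ¬ E p.2 ∧ 1 / 4 ≤ p.2.re := by
    rintro ⟨i, ρ⟩ hi
    rw [hs, Finset.mem_sigma] at hi
    obtain ⟨-, hρ⟩ := hi
    rw [hFin'] at hρ; dsimp only at hρ
    rw [Finset.mem_filter] at hρ
    have hρ' := hρ.1
    rw [hmemFin] at hρ'
    exact ⟨hρ.1, hρ'.1, hρ'.2, hρ.2.1, hρ.2.2⟩
  have hconv : ∑ i, ∑ ρ ∈ (finite_nontrivialZeros_inter (hF i) (hc₀ i) T₁).toFinset with (¬ E ρ ∧ 1 / 4 ≤ ρ.re),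
      (analyticOrderNatAt (F i) ρ : ℝ) * x ^ (ρ.re - 1) / max 1 |ρ.im| =
      ∑ p ∈ s, (analyticOrderNatAt (F p.1) p.2 : ℝ) * x ^ (p.2.re - 1) / max 1 |p.2.im| := by
    rw [hs, Finset.sum_sigma]
  rw [hconv]
  have key := LinnikZeroSum.sum_rpow_div_le_of_density_zfr s (fun p ↦ p.2.re) (fun p ↦ p.2.im)
    (fun p ↦ (analyticOrderNatAt (F p.1) p.2 : ℝ)) (𝓠 := 𝓠) (c_Z := c_Z) (b := b) (D₀ := D) (T₁ := T₁)
    hx h𝓠1 hcZ hb.le hD.le hT₁ (fun p _ ↦ Nat.cast_nonneg _) (fun p hp ↦ (hmem p hp).2.2.1) ?_ ?_ hrange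
  · exact key
  · -- the zero-free region off `E` (hypothesis)
    intro p hp
    obtain ⟨hfin, -, -, hexc, h14⟩ := hmem p hp
    exact hzfr p.1 p.2 hfin hexc h14
  · -- density
    intro T α hT hα
    have hd' := hdens T hT (fun i ↦ (Fin' i).filter (fun ρ ↦ |ρ.im| ≤ T)) (fun i ρ hρ ↦ ?_) α hα
    · refine le_of_eq_of_le ?_ hd'
      rw [hs]
      rw [show (∑ p ∈ (Finset.univ.sigma Fin') with (|p.2.im| ≤ T ∧ α ≤ p.2.re), (analyticOrderNatAt (F p.1) p.2 : ℝ)) =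
          ∑ p ∈ Finset.univ.sigma (fun i ↦ ((Fin' i).filter (fun ρ ↦ |ρ.im| ≤ T)).filter (fun ρ ↦ α ≤ ρ.re)),
            (analyticOrderNatAt (F p.1) p.2 : ℝ) by
        refine Finset.sum_congr ?_ fun _ _ ↦ rfl
        ext ⟨i, ρ⟩
        simp only [Finset.mem_filter, Finset.mem_sigma, Finset.mem_univ, true_and]
        tauto]
      rw [Finset.sum_sigma]
    · rw [Finset.mem_filter] at hρ
      rw [hFin'] at hρ; dsimp only at hρ
      rw [Finset.mem_filter, hmemFin] at hρ
      exact ⟨hρ.1.1.1.1, hρ.1.2.2, hρ.1.1.1.2.2, hρ.2⟩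

/-! ### The whole zero sum -/

set_option maxHeartbeats 4000000 in
/-- **Thorner–Zaman §4.3 for an abstract finite family, with the zero-free region as a parameter**: given the window
constant `W₀ ≥ 0` and density constants `b, D, a`, there are `ν ∈ (0, 1/64]`, `a₀ ≥ 1`, `A₀ > 0` (depending on
`W₀, b, D, a` ONLY) such that for every finite family `F_i` of entire functions non-zero at `c₀`, every `Q ≥ 12` with
`|ι| ≤ Q⁴`, window data `0 ≤ A ≤ 4Q`, the density bound in `Q`-form, every predicate `E`, every `x ≥ Q^{a₀}`, every
`c_Z > 0` such that every zero `ρ` of the family with `1/4 ≤ Re ρ < 1`, `|Im ρ| ≤ x`, `¬E ρ` has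
`Re ρ ≤ 1 − c_Z/(a log Q + log(|Im ρ| + 4))`, every `x^{−ν} ≤ ε ≤ 1` and all finite sets `u_i` of non-trivial zeros:
`Σ_i Σ_{ρ ∈ u_i, ¬E ρ} m_i(ρ)‖F(−ρ)‖ ≤ A₀ x (e^{−c_Z L/(4a log Q)} + e^{−√(c_Z L/4)}) + A₀ x^{1−ν}`.
[cite: ThornerZaman2019, §4.3] -/
theorem family_zeroSum_le_zfr (W₀ : ℝ) (hW₀0 : 0 ≤ W₀) {b D a : ℝ} (hb : 0 < b) (hD : 0 < D) (ha : 1 ≤ a) :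
    ∃ ν a₀ A₀ : ℝ, 0 < ν ∧ ν ≤ 1 / 64 ∧ 1 ≤ a₀ ∧ 0 < A₀ ∧
    ∀ (ι : Type) [Fintype ι] (F : ι → ℂ → ℂ) (hF : ∀ i, Differentiable ℂ (F i)) (c₀ : ℂ)
      (hc₀ : ∀ i, F i c₀ ≠ 0) (Q : ℝ), 12 ≤ Q → (Fintype.card ι : ℝ) ≤ Q ^ 4 →
      ∀ A : ℝ, 0 ≤ A → A ≤ 4 * Q →
      (∀ i (τ : ℝ) (P : Finset ℂ), (∀ ρ ∈ P, F i ρ = 0 ∧ 0 < ρ.re ∧ ρ.re < 1 ∧ |ρ.im - τ| ≤ 1 / 2) →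
        ∑ ρ ∈ P, (analyticOrderNatAt (F i) ρ : ℝ) ≤ W₀ * (A + Real.log (|τ| + 4))) →
      (∀ (T : ℝ), 1 ≤ T → ∀ u : ι → Finset ℂ,
        (∀ i, ∀ ρ ∈ u i, F i ρ = 0 ∧ 1 / 4 ≤ ρ.re ∧ ρ.re < 1 ∧ |ρ.im| ≤ T) →
        ∀ α : ℝ, α ≤ 1 →
          ∑ i, ∑ ρ ∈ u i with α ≤ ρ.re, (analyticOrderNatAt (F i) ρ : ℝ) ≤
            D * Real.exp (b * (a * Real.log Q + Real.log (T + 4))) ^ (1 - α)) →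
      ∀ (E : ℂ → Prop) [DecidablePred E],
      ∀ x : ℝ, Q ^ a₀ ≤ x → ∀ c_Z : ℝ, 0 < c_Z →
      (∀ i (ρ : ℂ), F i ρ = 0 → 1 / 4 ≤ ρ.re → ρ.re < 1 → |ρ.im| ≤ x → ¬ E ρ →
          ρ.re ≤ 1 - c_Z / (a * Real.log Q + Real.log (|ρ.im| + 4))) →
      ∀ ε : ℝ, x ^ (-ν) ≤ ε → ε ≤ 1 →
      ∀ u : ι → Finset ℂ, (∀ i, ∀ ρ ∈ u i, F i ρ = 0 ∧ 0 < ρ.re ∧ ρ.re < 1) →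
        ∑ i, ∑ ρ ∈ u i with ¬ E ρ,
            (analyticOrderNatAt (F i) ρ : ℝ) * ‖fordLaplace (tzTest (Real.log x) ε) (-ρ)‖ ≤
          A₀ * x * (Real.exp (-(c_Z * Real.log x / (4 * a * Real.log Q))) +
              Real.exp (-Real.sqrt (c_Z * Real.log x / 4))) + A₀ * x ^ (1 - ν) := by
  classical
  obtain ⟨M, hM1, hM⟩ := TZWeight.exists_smoothTransition_deriv_bound
  obtain ⟨hc₁16, hc₂0⟩ := tailConst_nonneg
  set β₀ : ℝ := max b 1 with hβ₀
  have hβ₀1 : 1 ≤ β₀ := le_max_right _ _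
  have hbβ₀ : b ≤ β₀ := le_max_left _ _
  set ν : ℝ := 1 / (64 * β₀) with hν
  have hν0 : 0 < ν := by positivity
  have hν64 : ν ≤ 1 / 64 := by
    rw [hν]; exact one_div_le_one_div_of_le (by norm_num) (by nlinarith)
  set a₀ : ℝ := 400 * a * β₀ with ha₀
  set A₁ : ℝ := 50 * W₀ * (1 / ν + 1 + 8 * M) + 2 * M * W₀ * (4 * tailConst₁ + tailConst₂) with hA₁
  have hA₁0 : 0 ≤ A₁ := by
    have : 0 ≤ M := by linarith
    have : 0 ≤ tailConst₁ := by linarith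
    positivity
  set A₀ : ℝ := Real.exp 1 * (512 * M * D + A₁) with hA₀
  refine ⟨ν, a₀, A₀, hν0, hν64, by rw [ha₀]; nlinarith, by positivity,
    fun ι _ F hF c₀ hc₀ Q hQ12 hcard A hAnn hAQ hwin hdens E _ x hx c_Z hcZ hzfr ε hεν hε1 u hu ↦ ?_⟩
  -- sizes
  have hQ1 : (1 : ℝ) < Q := by linarith
  have hlog12 : (2 : ℝ) ≤ Real.log 12 := by
    rw [Real.le_log_iff_exp_le (by norm_num)]
    have := Real.exp_one_lt_d9
    have h : Real.exp 2 = Real.exp 1 * Real.exp 1 := by rw [← Real.exp_add]; norm_num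
    rw [h]; nlinarith [Real.exp_pos (1:ℝ)]
  have hlogQ : 2 ≤ Real.log Q := hlog12.trans (Real.log_le_log (by norm_num) hQ12)
  have ha₀1 : (1 : ℝ) ≤ a₀ := by rw [ha₀]; nlinarith
  have hxQ : Q ≤ x := by
    have : Q ^ (1 : ℝ) ≤ Q ^ a₀ := Real.rpow_le_rpow_of_exponent_le hQ1.le ha₀1
    rw [Real.rpow_one] at this; linarith
  have hx1 : 1 < x := by linarith
  have hx0 : 0 < x := by linarith
  set Lx : ℝ := Real.log x with hLx
  have hLQ : a₀ * Real.log Q ≤ Lx := by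
    have := Real.log_le_log (by positivity) hx
    rwa [Real.log_rpow (by linarith)] at this
  have hL800 : 800 * β₀ ≤ Lx := by nlinarith
  have hL0 : 0 < Lx := by linarith
  have hε0 : 0 < ε := lt_of_lt_of_le (Real.rpow_pos_of_pos hx0 _) hεν
  have hεL : ε < Lx / 2 := by linarith
  set T₁ : ℝ := x ^ (6 * ν) with hT₁
  have hT₁1 : 1 ≤ T₁ := Real.one_le_rpow hx1.le (by positivity)
  have hT₁x : T₁ ≤ x := by
    have := Real.rpow_le_rpow_of_exponent_le hx1.le (by linarith : 6 * ν ≤ 1)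
    rwa [Real.rpow_one] at this
  have hmemFin : ∀ i (ρ : ℂ), ρ ∈ (finite_nontrivialZeros_inter (hF i) (hc₀ i) T₁).toFinset ↔
      (F i ρ = 0 ∧ 0 < ρ.re ∧ ρ.re < 1) ∧ |ρ.im| ≤ T₁ := by
    intro i ρ; rw [Set.Finite.mem_toFinset]; rfl
  -- the zero-free region on the finite sets
  have hzfr' : ∀ i, ∀ ρ ∈ (finite_nontrivialZeros_inter (hF i) (hc₀ i) T₁).toFinset, ¬ E ρ → 1 / 4 ≤ ρ.re →
      ρ.re ≤ 1 - c_Z / (a * Real.log Q + Real.log (|ρ.im| + 4)) := by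
    intro i ρ hρ hexc h14
    rw [hmemFin] at hρ
    exact hzfr i ρ hρ.1.1 h14 hρ.1.2.2 (hρ.2.trans hT₁x) hexc
  -- (A) per member
  set g : ι → ℂ → ℝ := fun i ρ ↦
    (analyticOrderNatAt (F i) ρ : ℝ) * ‖fordLaplace (TZWeight.tzTest Lx ε) (-ρ)‖ with hg
  set 𝓠 : ℝ := a * Real.log Q with h𝓠
  set S : ι → ℝ := fun i ↦
    ∑ ρ ∈ (finite_nontrivialZeros_inter (hF i) (hc₀ i) T₁).toFinset with (¬ E ρ ∧ 1 / 4 ≤ ρ.re),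
      (analyticOrderNatAt (F i) ρ : ℝ) * x ^ (ρ.re - 1) / max 1 |ρ.im| with hS
  set J : ℝ := (Lx + ε + 8 * M) * x ^ (-(3 : ℝ) / 4) * ((2 * T₁ + 3) * (W₀ * (A + Real.log (T₁ + 5)))) +
    (2 * M / ε) * T₁ ^ (-((1 : ℝ) / 2)) * (W₀ * (tailConst₁ * A + tailConst₂)) with hJ
  have hexpL : Real.exp Lx = x := by rw [hLx, Real.exp_log hx0]
  have hM0 : 0 ≤ M := by linarith
  have hper : ∀ i, ∑ ρ ∈ u i with ¬ E ρ, g i ρ ≤ Real.exp ε * x * (8 * M * S i + J) := by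
    intro i
    have hdp : DecidablePred (· ∈ nontrivialZeros (F i)) := fun _ ↦ Classical.propDecidable _
    set Exc : Finset ℂ := ((finite_nontrivialZeros_inter (hF i) (hc₀ i) T₁).toFinset ∪ u i).filter E with hExc
    set u' : Finset (nontrivialZeros (F i)) :=
      ((u i).filter (fun ρ ↦ ¬ E ρ)).subtype (· ∈ nontrivialZeros (F i)) with hu'
    have key := sum_zeroTerm_le (hF i) (hc₀ i) (W := W₀) (A := A) hW₀0 hAnn (hwin i) hM hL0 hε0 hεL hT₁1 Exc u'
    -- the left side
    have h1 : u'.filter (fun ρ' : nontrivialZeros (F i) ↦ (ρ' : ℂ) ∉ Exc) = u' := by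
      refine Finset.filter_true_of_mem fun ρ' hρ' ↦ ?_
      rw [hu', Finset.mem_subtype, Finset.mem_filter] at hρ'
      rw [hExc, Finset.mem_filter, not_and_or]
      exact Or.inr hρ'.2
    rw [h1] at key
    have hLHS : ∑ ρ' ∈ u', (analyticOrderNatAt (F i) (ρ' : ℂ) : ℝ) *
        ‖fordLaplace (TZWeight.tzTest Lx ε) (-(ρ' : ℂ))‖ = ∑ ρ ∈ u i with ¬ E ρ, g i ρ := by
      rw [hu', Finset.sum_subtype_of_mem (fun ρ : ℂ ↦ (analyticOrderNatAt (F i) ρ : ℝ) *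
        ‖fordLaplace (TZWeight.tzTest Lx ε) (-ρ)‖)]
      all_goals first
        | exact Finset.sum_congr rfl fun _ _ ↦ rfl
        | (intro ρ hρ; rw [Finset.mem_filter] at hρ; exact hu i ρ hρ.1)
    rw [hLHS] at key
    refine key.trans ?_
    rw [hexpL]
    refine mul_le_mul_of_nonneg_left ?_ (by positivity)
    rw [add_assoc]
    refine add_le_add ?_ ?_
    · -- the finite part: the filter `ρ ∉ Exc` is `¬ E` on the finite set
      refine mul_le_mul_of_nonneg_left (le_of_eq ?_) (by positivity)
      rw [hS]; dsimp only
      refine Finset.sum_congr (Finset.filter_congr fun ρ hρ ↦ ?_) fun _ _ ↦ rfl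
      rw [hExc, Finset.mem_filter, not_and_or]
      constructor
      · rintro ⟨h | h, h14⟩
        · exact absurd (Finset.mem_union_left _ hρ) h
        · exact ⟨h, h14⟩
      · rintro ⟨h, h14⟩; exact ⟨Or.inr h, h14⟩
    · -- the junk of `i`
      rw [hJ]
      refine add_le_add (mul_le_mul_of_nonneg_left ?_ ?_) le_rfl
      · change ∑ ρ ∈ (finite_nontrivialZeros_inter (hF i) (hc₀ i) T₁).toFinset,
          (analyticOrderNatAt (F i) ρ : ℝ) ≤ _
        refine sum_mult_le_of_window hW₀0 hAnn (hwin i) (by linarith) _ fun ρ hρ ↦ ?_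
        rw [hmemFin] at hρ
        exact ⟨hρ.1.1, hρ.1.2.1, hρ.1.2.2, hρ.2⟩
      · positivity
  -- (B) sum over `i`
  have hsum : ∑ i, ∑ ρ ∈ u i with ¬ E ρ, g i ρ ≤
      Real.exp ε * x * (8 * M * ∑ i, S i + (Fintype.card ι : ℝ) * J) := by
    refine (Finset.sum_le_sum fun i _ ↦ hper i).trans (le_of_eq ?_)
    rw [← Finset.mul_sum, Finset.sum_add_distrib, Finset.mul_sum, Finset.sum_const, nsmul_eq_mul,
      Finset.card_univ]
  -- (C) the finite part by density + ZFR
  have hrange : Real.exp (b * (a * Real.log Q + Real.log (2 * T₁ + 4))) ≤ x ^ ((1 : ℝ) / 2) := by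
    rw [show x ^ ((1 : ℝ) / 2) = Real.exp (Lx / 2) by rw [hLx, Real.rpow_def_of_pos hx0]; ring_nf]
    refine Real.exp_le_exp.2 ?_
    have hT6 : Real.log (2 * T₁ + 4) ≤ 2 + 6 * ν * Lx := by
      have h1 : Real.log (2 * T₁ + 4) ≤ Real.log (6 * T₁) :=
        Real.log_le_log (by linarith only [hT₁1]) (by linarith only [hT₁1])
      rw [Real.log_mul (by norm_num) (by linarith only [hT₁1]), hT₁, Real.log_rpow hx0, ← hLx] at h1
      have h3 : Real.log 6 ≤ 2 := by
        rw [Real.log_le_iff_le_exp (by norm_num)]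
        have := Real.exp_one_gt_d9
        have h : Real.exp 2 = Real.exp 1 * Real.exp 1 := by rw [← Real.exp_add]; norm_num
        rw [h]; nlinarith only [this]
      linarith only [h1, h3]
    have hbν : b * (6 * ν * Lx) ≤ 6 / 64 * Lx := by
      have hbν' : b * ν ≤ 1 / 64 := by
        rw [hν]; rw [show b * (1 / (64 * β₀)) = b / β₀ / 64 by ring]
        have : b / β₀ ≤ 1 := (div_le_one (by positivity)).2 hbβ₀
        linarith
      have : b * (6 * ν * Lx) = 6 * (b * ν) * Lx := by ring
      rw [this]
      have := mul_le_mul_of_nonneg_right hbν' hL0.le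
      linarith only [this]
    have hb2 : b * 2 ≤ Lx / 400 := by
      have : 1 ≤ a := ha
      nlinarith only [hbβ₀, hL800, this, hβ₀1]
    have hbQ : b * (a * Real.log Q) ≤ Lx / 400 := by
      have h0Q : 0 ≤ a * Real.log Q := by nlinarith only [hlogQ, ha]
      have h1 : b * (a * Real.log Q) ≤ β₀ * (a * Real.log Q) := mul_le_mul_of_nonneg_right hbβ₀ h0Q
      have h2' : β₀ * (a * Real.log Q) = (a₀ * Real.log Q) / 400 := by rw [ha₀]; ring
      rw [h2'] at h1
      have h3 : (a₀ * Real.log Q) / 400 ≤ Lx / 400 := by linarith only [hLQ]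
      linarith only [h1, h3]
    have h4 : b * Real.log (2 * T₁ + 4) ≤ b * 2 + b * (6 * ν * Lx) := by
      have := mul_le_mul_of_nonneg_left hT6 hb.le; linarith only [this]
    have h5 : b * (a * Real.log Q + Real.log (2 * T₁ + 4)) =
        b * (a * Real.log Q) + b * Real.log (2 * T₁ + 4) := by ring
    rw [h5]
    linarith only [hbQ, h4, hbν, hb2, hL0]
  have h𝓠1 : 1 ≤ 𝓠 := by rw [h𝓠]; nlinarith
  have hdens' : ∀ (T : ℝ), 1 ≤ T → ∀ u : ι → Finset ℂ,
      (∀ i, ∀ ρ ∈ u i, F i ρ = 0 ∧ 1 / 4 ≤ ρ.re ∧ ρ.re < 1 ∧ |ρ.im| ≤ T) → ∀ α : ℝ, α ≤ 1 →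
        ∑ i, ∑ ρ ∈ u i with α ≤ ρ.re, (analyticOrderNatAt (F i) ρ : ℝ) ≤
          D * Real.exp (b * (𝓠 + Real.log (T + 4))) ^ (1 - α) := by
    rw [h𝓠]; exact hdens
  have hrange' : Real.exp (b * (𝓠 + Real.log (2 * T₁ + 4))) ≤ x ^ ((1 : ℝ) / 2) := by rw [h𝓠]; exact hrange
  have hzfr'' : ∀ i, ∀ ρ ∈ (finite_nontrivialZeros_inter (hF i) (hc₀ i) T₁).toFinset, ¬ E ρ → 1 / 4 ≤ ρ.re →
      ρ.re ≤ 1 - c_Z / (𝓠 + Real.log (|ρ.im| + 4)) := by rw [h𝓠]; exact hzfr'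
  have hfin := family_finitePart_le_zfr hF hc₀ hb hD h𝓠1 hdens' E hcZ hx1 hT₁1 hzfr'' hrange'
  -- (D) the junk, with `Q²` in place of `Q` (`|ι| ≤ Q⁴ = (Q²)²`, `(Q²)³ = Q⁶ ≤ x^ν`)
  have hQsq12 : (12 : ℝ) ≤ Q ^ 2 := by nlinarith
  have hh : (Fintype.card ι : ℝ) ≤ (Q ^ 2) ^ 2 := by
    calc (Fintype.card ι : ℝ) ≤ Q ^ 4 := hcard
      _ = (Q ^ 2) ^ 2 := by ring
  have hAQ2 : A ≤ 4 * Q ^ 2 := by nlinarith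
  have hQ6 : (Q ^ 2) ^ 3 ≤ x ^ ν := by
    have h1 : (Q ^ 2) ^ 3 = Real.exp (6 * Real.log Q) := by
      rw [show (Q ^ 2) ^ 3 = Q ^ 6 by ring, ← Real.rpow_natCast, Real.rpow_def_of_pos (by linarith)]
      norm_num; ring_nf
    rw [h1, Real.rpow_def_of_pos hx0, ← hLx]
    refine Real.exp_le_exp.2 ?_
    have haν : a₀ * ν = 400 * a / 64 := by rw [ha₀, hν]; field_simp
    have h2' : ν * (a₀ * Real.log Q) ≤ ν * Lx := mul_le_mul_of_nonneg_left hLQ hν0.le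
    have h3 : ν * (a₀ * Real.log Q) = 400 * a / 64 * Real.log Q := by rw [← haν]; ring
    have h0Q : 0 ≤ Real.log Q := by linarith only [hlogQ]
    nlinarith only [h2', h3, h0Q, ha]
  have hjunk : (Fintype.card ι : ℝ) * J ≤ A₁ * x ^ (-ν) := by
    rw [hJ, hA₁, hT₁, hLx]
    exact junk_le hν0 hν64 hQsq12 hQ6 hx1 (Nat.cast_nonneg _) hh hAnn hAQ2 hM1 hW₀0
      (by linarith) hc₂0 hεν hε1
  -- (E) assemble
  have hεe : Real.exp ε ≤ Real.exp 1 := Real.exp_le_exp.2 hε1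
  set Eq' : ℝ := Real.exp (-(c_Z * Lx / (4 * 𝓠))) + Real.exp (-Real.sqrt (c_Z * Lx / 4)) with hEq'
  have hE0 : 0 ≤ Eq' := by positivity
  have hxν : x * x ^ (-ν) = x ^ (1 - ν) := by
    rw [sub_eq_add_neg, Real.rpow_add hx0, Real.rpow_one]
  have hE' : Real.exp (-(c_Z * Real.log x / (4 * a * Real.log Q))) +
      Real.exp (-Real.sqrt (c_Z * Real.log x / 4)) = Eq' := by
    rw [hEq', h𝓠, hLx]; ring_nf
  have hfin' : ∑ i, S i ≤ 64 * D * Eq' := by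
    rw [hEq', hLx]
    exact hfin
  rw [hE']
  have hgoal : ∑ i, ∑ ρ ∈ u i with ¬ E ρ,
      (analyticOrderNatAt (F i) ρ : ℝ) * ‖fordLaplace (tzTest (Real.log x) ε) (-ρ)‖ =
      ∑ i, ∑ ρ ∈ u i with ¬ E ρ, g i ρ := by rw [hg, hLx]
  rw [hgoal]
  calc ∑ i, ∑ ρ ∈ u i with ¬ E ρ, g i ρ
      ≤ Real.exp ε * x * (8 * M * ∑ i, S i + (Fintype.card ι : ℝ) * J) := hsum
    _ ≤ Real.exp 1 * x * (8 * M * (64 * D * Eq') + A₁ * x ^ (-ν)) := by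
        have hin : 0 ≤ 8 * M * ∑ i, S i + (Fintype.card ι : ℝ) * J := by
          have hS0 : 0 ≤ ∑ i, S i := Finset.sum_nonneg fun i _ ↦ by
            rw [hS]; exact Finset.sum_nonneg fun ρ _ ↦ div_nonneg (mul_nonneg (Nat.cast_nonneg _)
              (Real.rpow_nonneg hx0.le _)) (by positivity)
          have hJ0 : 0 ≤ J := by
            rw [hJ]
            have : 0 ≤ Real.log (T₁ + 5) := Real.log_nonneg (by linarith)
            have ht1 : 0 ≤ tailConst₁ := by linarith
            have : 0 ≤ tailConst₁ * A + tailConst₂ := by positivity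
            positivity
          positivity
        exact mul_le_mul (mul_le_mul_of_nonneg_right hεe hx0.le)
          (add_le_add (mul_le_mul_of_nonneg_left hfin' (by positivity)) hjunk) hin (by positivity)
    _ = Real.exp 1 * (512 * M * D) * x * Eq' + Real.exp 1 * A₁ * x ^ (1 - ν) := by rw [← hxν]; ring
    _ ≤ A₀ * x * Eq' + A₀ * x ^ (1 - ν) := by
        refine add_le_add ?_ ?_
        · rw [hA₀]
          have h0 : 0 ≤ Real.exp 1 * A₁ * (x * Eq') := by positivity
          nlinarith only [h0]
        · refine mul_le_mul_of_nonneg_right ?_ (Real.rpow_nonneg hx0.le _)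
          rw [hA₀]
          have : 0 ≤ Real.exp 1 * (512 * M * D) := by positivity
          nlinarith only [this]

end Literature.NumberTheory.LFunctions.EntireEF

end
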